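import Literature.Barriers.ResolutionOfSingularities.LocalMonomializationFailsLemmaShape
import HarnessLib

/-!
# Cutkosky's Lemma 3.1, towards (C4): expansions in `B̂_i`, divisor lemmas, the sheared pair `(ũ, v)`

`Literature/Barriers/ResolutionOfSingularities/LocalMonomializationFailsLemmaUnits.lean` — third
file of the discharge of `Literature.Barriers.ResolutionOfSingularities.Cutkosky.CutkoskyLemma31`
(Cutkosky, Math. Ann. 362 (2015), Lemma 3.1), preparing the proof that `A → B_i` is not monomial
for `0 ≤ i < p`:

* `expansions_in_Bi`: in `B̂_i = F[[x_i, y_i]]` one has `T_i u = x_iᵖ y_i^{pi} U₁`,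
  `T_i v = y_iⁱ (x_i E₂ + y_i^{p−i} E₃)` with units `U₁, E₂, E₃` of residues `c₀, e₀, τ̄₀` and
  `coeff_{y_i} U₁ = f₀` (the displayed expansions of the printed proof, first paragraph);
* two **divisor lemmas** in `F[[X,Y]]` replacing the unique-factorisation steps of the printed
  proof ("`w` is irreducible", "`w ∤ u`"): an element `W` with `W(0) = 0` and `coeff_X W ≠ 0`
  cannot divide both `T_i u` and `T_i v` (`false_of_dvd_Tu_of_dvd_Tv`), and an element with
  `W(0) = 0`, `coeff_X W = 0` satisfying `W·q = Yⁿ·w` with `coeff_X w ≠ 0` is divisible by `Y`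
  (`X_one_dvd_of_mul_eq_X_one_pow_mul`);
* the **sheared pair** `(ũ, v)`, `ũ = u − c·vᵖ`: it is algebraically independent, generates the
  same local ring `A`, and every non-unit of `A` is `h(ũ,v)/g(ũ,v)` with `h(0) = 0 ≠ g(0)`
  (`exists_rep_shear`) — the presentation in which leading forms of elements of `A` do not cancel.
-/

noncomputable section

namespace Literature.Barriers.ResolutionOfSingularities

namespace Cutkosky

open Literature.AlgebraicGeometry.Resolution Literature.RingTheory.TwoVariableSeries IsLocalRing

universe u

variable {F : Type u} [Field F] {L : Type u} [Field L] [Algebra F L]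

/-! ## The expansions of `u`, `v` in `B̂_i` -/

section Expansions

variable (p : ℕ) [hp : Fact p.Prime] {a b : Fin 2 → L} (ha : AlgebraicIndependent F a) (hb : AlgebraicIndependent F b)
  (hAB : originLocalRing ha ≤ originLocalRing hb)

/-- **The expansions in `B̂_i`** (`0 ≤ i < p`): `T_i u = Xᵖ Y^{pi} U₁`, `T_i v = Yⁱ(X E₂ + Y^{p−i} E₃)`
with `U₁(0) = c₀`, `coeff_Y U₁ = f₀`, `E₂(0) = e₀`, `E₃(0) = τ̄₀` (`X = x_i`, `Y = y_i`).
[cite: Cutkosky2014, Lemma 3.1 (proof, expansions of `u`, `v` in `B̂_i`)] -/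
theorem expansions_in_Bi {c₀ f₀ e₀ : F} {τ₀ : MvPowerSeries (Fin 2) F}
    (hshape : LemmaShape p hb ⟨a 0, hAB (mem_originLocalRing_self ha 0)⟩
      ⟨a 1, hAB (mem_originLocalRing_self ha 1)⟩ c₀ f₀ e₀ τ₀)
    (α : F) {i : ℕ} (hi : i < p) (hB : AlgebraicIndependent F (bCoord F L p (b 0) (b 1) α i)) :
    ∃ (hleB : originLocalRing hb ≤ originLocalRing hB) (U₁ E₂ E₃ : MvPowerSeries (Fin 2) F),
      MvPowerSeries.constantCoeff U₁ = c₀ ∧ MvPowerSeries.coeff (Finsupp.single 1 1) U₁ = f₀ ∧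
      MvPowerSeries.constantCoeff E₂ = e₀ ∧ MvPowerSeries.constantCoeff E₃ = MvPowerSeries.constantCoeff τ₀ ∧
      originTaylorAt hB ⟨a 0, hleB (hAB (mem_originLocalRing_self ha 0))⟩ =
        MvPowerSeries.X 0 ^ p * MvPowerSeries.X 1 ^ (p * i) * U₁ ∧
      originTaylorAt hB ⟨a 1, hleB (hAB (mem_originLocalRing_self ha 1))⟩ =
        MvPowerSeries.X 1 ^ i * (MvPowerSeries.X 0 * E₂ + MvPowerSeries.X 1 ^ (p - i) * E₃) := by
  have hp0 : p ≠ 0 := hp.out.ne_zero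
  obtain ⟨u₁, v₂, v₃, hu, hv, hu₁, hDu₁, hv₂, hv₃⟩ := exists_decomp_of_lemmaShape hb hp0 hshape
  obtain ⟨hle, hmax, hTx, hTy⟩ := le_Bi p hb α hi hB
  refine ⟨hle, originTaylorAt hB (Subalgebra.inclusion hle u₁), originTaylorAt hB (Subalgebra.inclusion hle v₂),
    originTaylorAt hB (Subalgebra.inclusion hle v₃), ?_, ?_, ?_, ?_, ?_, ?_⟩
  · rw [← hu₁]; exact constantCoeff_originTaylorAt_inclusion hb hB hle hmax u₁.2
  · rw [← hDu₁]
    refine coeff_single_one_originTaylorAt_inclusion hb hB hle 1 1 hmax (Fin.forall_fin_two.mpr ⟨?_, ?_⟩) u₁.2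
    · rw [hTx, coeff_single_one_one_X_zero_mul, coeff_single_one_one_X_zero]
    · rw [hTy]
  · rw [← hv₂]; exact constantCoeff_originTaylorAt_inclusion hb hB hle hmax v₂.2
  · rw [← hv₃]; exact constantCoeff_originTaylorAt_inclusion hb hB hle hmax v₃.2
  · have e : (⟨a 0, hle (hAB (mem_originLocalRing_self ha 0))⟩ : originLocalRing hB) =
        Subalgebra.inclusion hle ⟨a 0, hAB (mem_originLocalRing_self ha 0)⟩ := rfl
    have hxB : Subalgebra.inclusion hle (originCoord hb 0) = ⟨b 0, hle (mem_originLocalRing_self hb 0)⟩ := rfl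
    rw [e, hu, map_mul, map_pow, map_mul, map_pow, hxB, hTx, mul_pow, ← pow_mul, mul_comm i p]
  · have e : (⟨a 1, hle (hAB (mem_originLocalRing_self ha 1))⟩ : originLocalRing hB) =
        Subalgebra.inclusion hle ⟨a 1, hAB (mem_originLocalRing_self ha 1)⟩ := rfl
    have hxB : Subalgebra.inclusion hle (originCoord hb 0) = ⟨b 0, hle (mem_originLocalRing_self hb 0)⟩ := rfl
    have hyB : Subalgebra.inclusion hle (originCoord hb 1) = ⟨b 1, hle (mem_originLocalRing_self hb 1)⟩ := rfl
    rw [e, hv]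
    simp only [map_add, map_mul, map_pow]
    rw [hxB, hyB, hTx, hTy]
    have hsplit : (MvPowerSeries.X 1 : MvPowerSeries (Fin 2) F) ^ p = MvPowerSeries.X 1 ^ i * MvPowerSeries.X 1 ^ (p - i) := by
      rw [← pow_add, Nat.add_sub_cancel' hi.le]
    rw [hsplit]
    ring

end Expansions

/-! ## Divisor lemmas in `F[[X, Y]]` -/

section Divisors

variable {p i : ℕ} {U₁ E₂ E₃ : MvPowerSeries (Fin 2) F}

/-- The inner factor `w = X E₂ + Y^{p−i} E₃` of `T_i v`: `w(0) = 0`, its restrictions to both axes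
are nonzero, and `coeff_X w = e₀`. [folklore] -/
theorem inner_factor_facts (hip : i < p) (hE₂ : MvPowerSeries.constantCoeff E₂ ≠ 0)
    (hE₃ : MvPowerSeries.constantCoeff E₃ ≠ 0) :
    MvPowerSeries.constantCoeff (MvPowerSeries.X 0 * E₂ + MvPowerSeries.X 1 ^ (p - i) * E₃) = 0 ∧
    killVar 0 (MvPowerSeries.X 0 * E₂ + MvPowerSeries.X 1 ^ (p - i) * E₃) ≠ 0 ∧
    killVar 1 (MvPowerSeries.X 0 * E₂ + MvPowerSeries.X 1 ^ (p - i) * E₃) ≠ 0 ∧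
    MvPowerSeries.coeff (Finsupp.single 0 1) (MvPowerSeries.X 0 * E₂ + MvPowerSeries.X 1 ^ (p - i) * E₃) =
      MvPowerSeries.constantCoeff E₂ := by
  have hpi : p - i ≠ 0 := by omega
  have hκE₃ : killVar 0 E₃ ≠ 0 := fun h0 => hE₃ (by rw [← constantCoeff_killVar 0, h0, map_zero])
  have hκE₂ : killVar 1 E₂ ≠ 0 := fun h0 => hE₂ (by rw [← constantCoeff_killVar 1, h0, map_zero])
  refine ⟨?_, ?_, ?_, ?_⟩
  · rw [map_add, map_mul, map_mul, MvPowerSeries.constantCoeff_X, constantCoeff_X_pow hpi, zero_mul, zero_mul, add_zero]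
  · rw [map_add, map_mul, map_mul, killVar_X_self, zero_mul, zero_add, killVar_zero_X_one_pow]
    exact mul_ne_zero (pow_ne_zero _ PowerSeries.X_ne_zero) hκE₃
  · rw [map_add, map_mul, map_mul, killVar_one_X_zero, map_pow, killVar_X_self, zero_pow hpi, zero_mul, add_zero]
    exact mul_ne_zero PowerSeries.X_ne_zero hκE₂
  · rw [map_add, coeff_single_one_X_mul, coeff_single_zero_one_X_one_pow_mul hpi, add_zero]

/-- **First divisor lemma.** An element `W ∈ F[[X,Y]]` with `W(0) = 0` and `coeff_X W ≠ 0` cannot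
divide both `T_i u = Xᵖ Y^{pi} U₁` and `T_i v = Yⁱ (X E₂ + Y^{p−i} E₃)` (`Eⱼ`, `U₁` units,
`0 ≤ i < p`): cancelling `Yⁱ` it would divide, hence be a unit multiple of, the inner factor `w`,
and `w` divides no `Xᵃ Yᵇ · unit`. (In the printed proof: "`w ∤ u` in `B̂`".)
[cite: Cutkosky2014, Lemma 3.1 (proof of non-monomiality)] -/
theorem false_of_dvd_Tu_of_dvd_Tv (hip : i < p) (hU₁ : MvPowerSeries.constantCoeff U₁ ≠ 0)
    (hE₂ : MvPowerSeries.constantCoeff E₂ ≠ 0) (hE₃ : MvPowerSeries.constantCoeff E₃ ≠ 0)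
    {W : MvPowerSeries (Fin 2) F} (hW0 : MvPowerSeries.constantCoeff W = 0)
    (hWX : MvPowerSeries.coeff (Finsupp.single 0 1) W ≠ 0)
    (hu : W ∣ MvPowerSeries.X 0 ^ p * MvPowerSeries.X 1 ^ (p * i) * U₁)
    (hv : W ∣ MvPowerSeries.X 1 ^ i * (MvPowerSeries.X 0 * E₂ + MvPowerSeries.X 1 ^ (p - i) * E₃)) : False := by
  obtain ⟨hw0, hκ0w, hκ1w, hwX⟩ := inner_factor_facts (F := F) hip hE₂ hE₃
  set w := MvPowerSeries.X 0 * E₂ + MvPowerSeries.X 1 ^ (p - i) * E₃ with hw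
  have hκ1W : killVar 1 W ≠ 0 := fun h0 => hWX (by rw [← coeff_killVar_one, h0, map_zero])
  obtain ⟨q, hq⟩ := dvd_of_dvd_X_pow_mul hκ1W i hv
  -- `q` is a unit: compare the coefficients of `X`
  have hq0 : MvPowerSeries.constantCoeff q ≠ 0 := by
    have h := congrArg (MvPowerSeries.coeff (Finsupp.single 0 1)) hq
    rw [hwX, coeff_single_one_mul, hW0, zero_mul, zero_add] at h
    intro h0
    rw [h0, mul_zero] at h
    exact hE₂ h
  obtain ⟨qu, hqu⟩ := isUnit_of_constantCoeff_ne_zero hq0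
  have hwW : w ∣ W := ⟨↑qu⁻¹, by rw [hq, ← hqu, Units.mul_inv_cancel_right]⟩
  exact not_dvd_X_pow_mul_X_pow_mul hw0 hκ0w hκ1w (isUnit_of_constantCoeff_ne_zero hU₁) p (p * i) (hwW.trans hu)

/-- **Second divisor lemma.** If `W(0) = 0`, `coeff_X W = 0`, `coeff_X w ≠ 0` and `W · q = Yⁿ · w`,
then `Y ∣ W` (kill `Y` and cancel, `n` times; at the end `w = W·q'` would have `coeff_X w = 0`).
(In the printed proof: a prime divisor of `y_iⁱ w` other than `w` is `y_i`.)
[cite: Cutkosky2014, Lemma 3.1 (proof of non-monomiality, case `1 ≤ i`)] -/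
theorem X_one_dvd_of_mul_eq_X_one_pow_mul {W w : MvPowerSeries (Fin 2) F} (hW0 : MvPowerSeries.constantCoeff W = 0)
    (hWX : MvPowerSeries.coeff (Finsupp.single 0 1) W = 0) (hwX : MvPowerSeries.coeff (Finsupp.single 0 1) w ≠ 0)
    {n : ℕ} {q : MvPowerSeries (Fin 2) F} (h : W * q = MvPowerSeries.X 1 ^ n * w) :
    (MvPowerSeries.X 1 : MvPowerSeries (Fin 2) F) ∣ W := by
  haveI := isDomain_mvPowerSeries (F := F) (Fin 2)
  induction n generalizing q with
  | zero =>
    exfalso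
    have hc := congrArg (MvPowerSeries.coeff (Finsupp.single 0 1)) h
    rw [pow_zero, one_mul, coeff_single_one_mul, hW0, hWX, zero_mul, zero_mul, zero_add] at hc
    exact hwX hc.symm
  | succ n ih =>
    have hκ : killVar 1 W * killVar 1 q = 0 := by
      rw [← map_mul, h, map_mul, map_pow, killVar_X_self, zero_pow (Nat.succ_ne_zero n), zero_mul]
    rcases mul_eq_zero.mp hκ with h0 | h0
    · exact (killVar_eq_zero_iff 1 W).mp h0
    · obtain ⟨q', rfl⟩ := (killVar_eq_zero_iff 1 q).mp h0
      apply ih (q := q')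
      apply mul_left_cancel₀ (X_ne_zero' (F := F) 1)
      rw [← mul_assoc (MvPowerSeries.X 1) (MvPowerSeries.X 1 ^ n), ← pow_succ', ← h]
      ring

end Divisors

/-! ## The sheared pair `(ũ, v)`, `ũ = u − c vⁿ` -/

section Shear

variable {a : Fin 2 → L} (ha : AlgebraicIndependent F a) (c : F) (n : ℕ)

/-- The sheared pair `(u − c vⁿ, v)`. [folklore] -/
theorem shear_apply (j : Fin 2) :
    ![a 0 - algebraMap F L c * a 1 ^ n, a 1] j =
      MvPolynomial.aeval a (![MvPolynomial.X 0 - MvPolynomial.C c * MvPolynomial.X 1 ^ n, MvPolynomial.X 1] j) := by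
  fin_cases j <;> simp

include ha in
/-- **The sheared pair is algebraically independent** (the shear `U ↦ U − c Vⁿ` is an automorphism of
`F[U, V]`). [folklore] -/
theorem algebraicIndependent_shear : AlgebraicIndependent F ![a 0 - algebraMap F L c * a 1 ^ n, a 1] := by
  rw [algebraicIndependent_iff_injective_aeval] at ha ⊢
  set σ : MvPolynomial (Fin 2) F →ₐ[F] MvPolynomial (Fin 2) F :=
    MvPolynomial.bind₁ ![MvPolynomial.X 0 - MvPolynomial.C c * MvPolynomial.X 1 ^ n, MvPolynomial.X 1] with hσ
  set σ' : MvPolynomial (Fin 2) F →ₐ[F] MvPolynomial (Fin 2) F :=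
    MvPolynomial.bind₁ ![MvPolynomial.X 0 + MvPolynomial.C c * MvPolynomial.X 1 ^ n, MvPolynomial.X 1] with hσ'
  have hfun : (fun j => MvPolynomial.aeval a
      (![MvPolynomial.X 0 - MvPolynomial.C c * MvPolynomial.X 1 ^ n, MvPolynomial.X 1] j)) =
      ![a 0 - algebraMap F L c * a 1 ^ n, a 1] :=
    funext fun j => (shear_apply c n j).symm
  have hcomp : ∀ φ : MvPolynomial (Fin 2) F,
      MvPolynomial.aeval ![a 0 - algebraMap F L c * a 1 ^ n, a 1] φ = MvPolynomial.aeval a (σ φ) := by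
    intro φ
    rw [hσ, MvPolynomial.aeval_bind₁, hfun]
  have hinv : ∀ φ : MvPolynomial (Fin 2) F, σ' (σ φ) = φ := by
    intro φ
    rw [← AlgHom.comp_apply]
    conv_rhs => rw [← AlgHom.id_apply (R := F) φ]
    congr 1
    apply MvPolynomial.algHom_ext
    intro j
    rw [AlgHom.comp_apply, AlgHom.id_apply, hσ, MvPolynomial.bind₁_X_right]
    fin_cases j
    · simp [hσ', MvPolynomial.bind₁_X_right]
    · simp [hσ', MvPolynomial.bind₁_X_right]
  intro φ ψ hφψ
  rw [hcomp, hcomp] at hφψ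
  have h := congrArg σ' (ha hφψ)
  rwa [hinv, hinv] at h

/-- **The sheared pair generates the same local ring, with the same maximal ideal membership for the
old coordinates**: `F[u,v]_{(u,v)} ≤ F[ũ,v]_{(ũ,v)}` and `u, v ∈ 𝔪` there (for `n ≠ 0`), and
conversely. [folklore] -/
theorem le_shear_and_shear_le (hn : n ≠ 0) (ha' : AlgebraicIndependent F ![a 0 - algebraMap F L c * a 1 ^ n, a 1]) :
    (∃ hle : originLocalRing ha ≤ originLocalRing ha',
      ∀ j, haveI := isLocalRing_originLocalRing ha';
        (⟨a j, hle (mem_originLocalRing_self ha j)⟩ : originLocalRing ha') ∈ maximalIdeal (originLocalRing ha')) ∧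
    originLocalRing ha' ≤ originLocalRing ha := by
  constructor
  · obtain ⟨hle, hmax, -⟩ := le_and_originTaylorAt_eq_of_eq_aeval ha ha'
      ![MvPolynomial.X 0 + MvPolynomial.C c * MvPolynomial.X 1 ^ n, MvPolynomial.X 1]
      (fun j => by fin_cases j <;> simp [MvPolynomial.constantCoeff_X, hn])
      (fun j => by
        fin_cases j
        · simp
        · simp)
    exact ⟨hle, hmax⟩
  · obtain ⟨hle, -, -⟩ := le_and_originTaylorAt_eq_of_eq_aeval ha' ha
      ![MvPolynomial.X 0 - MvPolynomial.C c * MvPolynomial.X 1 ^ n, MvPolynomial.X 1]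
      (fun j => by fin_cases j <;> simp [MvPolynomial.constantCoeff_X, hn])
      (fun j => by fin_cases j <;> simp)
    exact hle

/-- **Representation of non-units of `A` in the sheared pair**: every `z ∈ A = F[u,v]_{(u,v)}` whose
inverse is not in `A` is `h(ũ,v)/g(ũ,v)` with `g(0) ≠ 0` and `h(0) = 0`; if `z ≠ 0` then `h ≠ 0`.
[folklore] -/
theorem exists_rep_shear (hn : n ≠ 0) (ha' : AlgebraicIndependent F ![a 0 - algebraMap F L c * a 1 ^ n, a 1])
    {z : L} (hz : z ∈ originLocalRing ha) (hzinv : z⁻¹ ∉ originLocalRing ha) :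
    ∃ h g : MvPolynomial (Fin 2) F, MvPolynomial.constantCoeff g ≠ 0 ∧ MvPolynomial.constantCoeff h = 0 ∧
      z = MvPolynomial.aeval ![a 0 - algebraMap F L c * a 1 ^ n, a 1] h /
        MvPolynomial.aeval ![a 0 - algebraMap F L c * a 1 ^ n, a 1] g ∧
      (z ≠ 0 → h ≠ 0) := by
  obtain ⟨⟨hle, -⟩, hle'⟩ := le_shear_and_shear_le ha c n hn ha'
  obtain ⟨h, g, hg, hzhg⟩ := (mem_originLocalRing_iff ha').mp (hle hz)
  refine ⟨h, g, hg, ?_, hzhg, ?_⟩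
  · by_contra hh
    apply hzinv
    apply hle'
    rw [hzhg, inv_div]
    exact (mem_originLocalRing_iff ha').mpr ⟨g, h, hh, rfl⟩
  · rintro hz0 rfl
    apply hz0
    rw [hzhg, map_zero, zero_div]

end Shear

end Cutkosky

end Literature.Barriers.ResolutionOfSingularities
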